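import Mathlib
import Summits.NavierStokesRegularity.NavierStokesRegularity.Theorems.SlicedKelvinPlanarFluxAPrioriHeatPairing

/-!
# Crux `SlicedKelvin.PlanarFluxAPriori` (stmt-NavierStokesRegularity-15600), line `registered`:
  the one-dimensional heat DUALITY (Duhamel comparison) bound (helper for `stub_heatKernelDomination`)

Third of three files. The heat-kernel domination step of the skeleton `Cruxes/PlanarFluxAPriori/Lines/birth.lean`
needs, for the regularised planar flux profile `φ_ε(τ, c)` of a solution (a bounded classical subsolution of
`∂_τ − ν∂_c² ≤ S` in the height `c`, by the ε-fold law), the DUHAMEL COMPARISON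

  `φ(t, c₀) ≤ sup φ(0, ·) + (4π)^{-1/2} ∫_{(0,t)} (ν(t−τ))^{-1/2} (∫ S(τ, c)⁺ dc) dτ`.

`heat_subsolution_duhamel_bound` proves exactly this for every jointly continuous `φ` bounded by `B` on
`[0,t] × ℝ` with bounded derivatives `φₜ, ∂_cφ, ∂_c²φ` on `(0,t) × ℝ` (`φₜ, ∂_c²φ` jointly continuous) and
`φₜ − ν∂_c²φ ≤ S`, `φ(0,·) ≤ M₀`, in the `ℝ≥0∞` currency of the stub: the source enters only through
`∫⁻ ofReal S` (no measurability, sign or integrability of `S`), the weight is the stub's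
`ofReal (1/√(ν(t−τ)))` and the constant is `ofReal (1/√(4π))`. Proof (duality, no maximum principle): with
`I(τ) = ∫ G_{ν(t−τ)}(c₀−c) φ(τ,c) dc`, the pairing calculus of `…HeatPairing` gives `I' = ∫ G (φₜ − νφ_cc)`
(the kernel solves the backward equation in `τ`; two integrations by parts), hence
`ofReal I' ≤ (4π)^{-1/2}(ν(t−τ))^{-1/2} ∫⁻ ofReal S` (kernel sup); the fundamental theorem of calculus on
`[a, b] ⊂ (0,t)` and the endpoint limits `I(0⁺) = I(0) ≤ M₀` (`tendsto_integral_heatKernel_mul_nhdsGT_zero`,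
dominated convergence) and `I(t⁻) = φ(t, c₀)` (`tendsto_integral_heatKernel_mul_nhdsLT`: the tree's approximate
identity `tendsto_heatExtension_nhdsWithin_prod` plus the mean-value bound `|φ(τ,·) − φ(t,·)| ≤ B(t−τ)`)
conclude. Mathlib and the tree's heat kernel only; no fluid mechanics enters.
-/

noncomputable section

-- Problem = summit for this single-conjunct summit: the duplicate namespace component is deliberate.
set_option linter.dupNamespace false

namespace Summit.NavierStokesRegularity.NavierStokesRegularity.Theorems.SlicedKelvinPlanarFluxAPriori

open MeasureTheory Set Real Filter Topology ENNReal
open Literature.Analysis.UnboundedOperators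

/-! ### The pairing against the initial data and its endpoint limits -/

/-- Integrability of `c ↦ G_s(c₀ − c) f(c)` for continuous bounded `f` and `0 < s`. -/
theorem integrable_heatKernel_sub_mul {s B : ℝ} (hs : 0 < s) (c₀ : ℝ) {f : ℝ → ℝ} (hf : Continuous f)
    (hfB : ∀ c, |f c| ≤ B) : Integrable fun c => heatKernel s (c₀ - c) * f c :=
  ((integrable_heatKernel_holds (E := ℝ) hs).comp_sub_left c₀).mul_bdd hf.aestronglyMeasurable
    (ae_of_all _ fun c => by rw [Real.norm_eq_abs]; exact hfB c)

/-- `∫ G_s(c₀ − c) dc = 1` (`0 < s`). -/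
theorem integral_heatKernel_sub_eq_one {s : ℝ} (hs : 0 < s) (c₀ : ℝ) :
    ∫ c, heatKernel s (c₀ - c) = 1 := by
  rw [integral_sub_left_eq_self (heatKernel (E := ℝ) s) volume c₀]
  exact integral_heatKernel_eq_one_holds hs

/-- **The pairing against data bounded above**: `∫ G_s(c₀ − c) f(c) dc ≤ M₀` if `f ≤ M₀` (`f` continuous
and bounded, `0 < s`; `G ≥ 0`, `∫ G = 1`). -/
theorem integral_heatKernel_sub_mul_le {s B M₀ : ℝ} (hs : 0 < s) (c₀ : ℝ) {f : ℝ → ℝ} (hf : Continuous f)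
    (hfB : ∀ c, |f c| ≤ B) (hle : ∀ c, f c ≤ M₀) : ∫ c, heatKernel s (c₀ - c) * f c ≤ M₀ := by
  have hGint : Integrable fun c => heatKernel (E := ℝ) s (c₀ - c) :=
    (integrable_heatKernel_holds (E := ℝ) hs).comp_sub_left c₀
  calc ∫ c, heatKernel s (c₀ - c) * f c ≤ ∫ c, heatKernel s (c₀ - c) * M₀ :=
        integral_mono (integrable_heatKernel_sub_mul hs c₀ hf hfB) (hGint.mul_const _) fun c =>
          mul_le_mul_of_nonneg_left (hle c) (heatKernel_real_nonneg hs _)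
    _ = M₀ := by rw [integral_mul_const, integral_heatKernel_sub_eq_one hs, one_mul]

/-- **Right-continuity at `τ = 0` of the caloric pairing** `τ ↦ ∫ G_{ν(t−τ)}(c₀−c) φ(τ,c) dc` for `φ`
jointly continuous and bounded on `[0,t] × ℝ` (dominated convergence). -/
theorem tendsto_integral_heatKernel_mul_nhdsGT_zero {ν t B : ℝ} (hν : 0 < ν) (ht : 0 < t)
    {φ : ℝ → ℝ → ℝ} (hcont : ContinuousOn (Function.uncurry φ) (Icc 0 t ×ˢ univ))
    (hB : ∀ τ ∈ Icc 0 t, ∀ c, |φ τ c| ≤ B) (c₀ : ℝ) :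
    Tendsto (fun τ => ∫ c, heatKernel (ν * (t - τ)) (c₀ - c) * φ τ c) (𝓝[>] 0)
      (𝓝 (∫ c, heatKernel (ν * t) (c₀ - c) * φ 0 c)) := by
  set s₀ : ℝ := ν * t with hs₀
  have hs₀pos : 0 < s₀ := mul_pos hν ht
  have hS : ∀ τ ∈ Ico 0 (t / 2), τ ∈ Icc 0 t ∧ ν * (t - τ) ∈ Icc (s₀ / 2) (2 * s₀) := by
    intro τ hτ
    refine ⟨⟨hτ.1, by linarith [hτ.2]⟩, ?_, ?_⟩
    · rw [hs₀]; nlinarith [hτ.2]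
    · rw [hs₀]; nlinarith [hτ.1]
  have hB0 : 0 ≤ B := (abs_nonneg _).trans (hB 0 ⟨le_rfl, ht.le⟩ 0)
  set A : ℝ := (4 * π * (s₀ / 2)) ^ (-(1 : ℝ) / 2) with hA
  have hA0 : 0 ≤ A := by positivity
  have hb : 0 < 1 / (16 * s₀) := by positivity
  have hG_le : ∀ τ ∈ Ico 0 (t / 2), ∀ c, |heatKernel (ν * (t - τ)) (c₀ - c)| ≤
      A * Real.exp (-(1 / (16 * s₀)) * (c₀ - c) ^ 2) := by
    intro τ hτ c
    obtain ⟨-, hsI⟩ := hS τ hτ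
    have hs : 0 < ν * (t - τ) := by linarith [hsI.1]
    rw [abs_of_nonneg (heatKernel_real_nonneg hs _)]
    refine (heatKernel_le_gaussian_of_mem_Icc hs₀pos hsI (c₀ - c)).trans ?_
    refine mul_le_mul_of_nonneg_left (Real.exp_le_exp.2 ?_) hA0
    refine mul_le_mul_of_nonneg_right (neg_le_neg ?_) (by positivity)
    exact one_div_le_one_div_of_le (by positivity) (by linarith)
  have hGcont : ∀ τ, Continuous fun c => heatKernel (ν * (t - τ)) (c₀ - c) := fun τ =>
    (continuous_heatKernel (E := ℝ) _).comp (continuous_const.sub continuous_id)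
  have hmem : Ico 0 (t / 2) ∈ 𝓝[Ico 0 (t / 2)] (0 : ℝ) := self_mem_nhdsWithin
  have key : ContinuousWithinAt (fun τ => ∫ c, heatKernel (ν * (t - τ)) (c₀ - c) * φ τ c)
      (Ico 0 (t / 2)) 0 := by
    refine continuousWithinAt_of_dominated
      (bound := fun c => A * Real.exp (-(1 / (16 * s₀)) * (c₀ - c) ^ 2) * B) ?_ ?_ ?_ ?_
    · filter_upwards [hmem] with τ hτ
      exact ((hGcont τ).mul (continuous_slice_right hcont (hS τ hτ).1)).aestronglyMeasurable
    · filter_upwards [hmem] with τ hτ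
      refine ae_of_all _ fun c => ?_
      rw [Real.norm_eq_abs, abs_mul]
      exact mul_le_mul (hG_le τ hτ c) (hB τ (hS τ hτ).1 c) (abs_nonneg _) (by positivity)
    · exact (((integrable_exp_neg_mul_sq hb).comp_sub_left c₀).const_mul A).mul_const B
    · refine ae_of_all _ fun c => ?_
      have h1 : ContinuousAt (fun τ : ℝ => heatKernel (ν * (t - τ)) (c₀ - c)) 0 := by
        have hd := (hasDerivAt_heatKernel_time_real (s := ν * (t - 0)) (by simpa using hs₀pos)
          (c₀ - c)).continuousAt
        have hlin : Continuous fun τ : ℝ => ν * (t - τ) := by fun_prop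
        exact hd.comp_of_eq hlin.continuousAt rfl
      have h2 : ContinuousWithinAt (fun τ => φ τ c) (Ico 0 (t / 2)) 0 :=
        ((continuousOn_slice_left hcont c) 0 ⟨le_rfl, ht.le⟩).mono fun τ hτ => (hS τ hτ).1
      exact h1.continuousWithinAt.mul h2
  have h := key.tendsto
  simp only [sub_zero] at h
  rw [← nhdsWithin_Ioo_eq_nhdsGT (half_pos ht)]
  exact h.mono_left (nhdsWithin_mono _ Ioo_subset_Ico_self)

/-- **Limit at `τ → t⁻` of the caloric pairing**: `∫ G_{ν(t−τ)}(c₀−c) φ(τ,c) dc → φ(t, c₀)` for `φ`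
jointly continuous and bounded on `[0,t] × ℝ` with `|∂_τφ| ≤ B` on `(0,t)` (approximate identity for the
slice `φ(t,·)` — the tree's `tendsto_heatExtension_nhdsWithin_prod` — plus the mean-value bound
`|φ(τ,c) − φ(t,c)| ≤ B (t − τ)` against `∫ G = 1`). -/
theorem tendsto_integral_heatKernel_mul_nhdsLT {ν t B : ℝ} (hν : 0 < ν) (ht : 0 < t)
    {φ φₜ : ℝ → ℝ → ℝ} (hcont : ContinuousOn (Function.uncurry φ) (Icc 0 t ×ˢ univ))
    (hdt : ∀ τ ∈ Ioo 0 t, ∀ c, HasDerivAt (fun σ => φ σ c) (φₜ τ c) τ)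
    (hB : ∀ τ ∈ Icc 0 t, ∀ c, |φ τ c| ≤ B) (hBt : ∀ τ ∈ Ioo 0 t, ∀ c, |φₜ τ c| ≤ B) (c₀ : ℝ) :
    Tendsto (fun τ => ∫ c, heatKernel (ν * (t - τ)) (c₀ - c) * φ τ c) (𝓝[<] t) (𝓝 (φ t c₀)) := by
  have htI : t ∈ Icc 0 t := ⟨ht.le, le_rfl⟩
  have hφt_cont : Continuous (φ t) := continuous_slice_right hcont htI
  have hφt_bdd : ∀ z, ‖φ t z‖ ≤ B := fun z => by rw [Real.norm_eq_abs]; exact hB t htI z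
  -- the approximate identity for the final slice
  have hE : Tendsto (fun b => heatExtension (φ t) (ν * (t - b)) c₀) (𝓝[<] t) (𝓝 (φ t c₀)) := by
    have h1 := tendsto_heatExtension_nhdsWithin_prod (E := ℝ) (F := ℝ) hφt_cont hφt_bdd c₀
    have h2 : Tendsto (fun b : ℝ => (ν * (t - b), c₀)) (𝓝[<] t)
        (𝓝[Ioi 0 ×ˢ univ] ((0 : ℝ), c₀)) := by
      refine tendsto_nhdsWithin_iff.2 ⟨?_, ?_⟩
      · have hc : Continuous fun b : ℝ => (ν * (t - b), c₀) := by fun_prop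
        have h3 := hc.tendsto t
        simp only [sub_self, mul_zero] at h3
        exact h3.mono_left nhdsWithin_le_nhds
      · filter_upwards [self_mem_nhdsWithin] with b hb
        exact mk_mem_prod (mul_pos hν (by simpa using hb)) (mem_univ _)
    have h3 := h1.comp h2
    exact h3
  -- the difference is `O(t - b)`
  have hdiff : ∀ b ∈ Ioo 0 t, |(∫ c, heatKernel (ν * (t - b)) (c₀ - c) * φ b c) -
      heatExtension (φ t) (ν * (t - b)) c₀| ≤ B * (t - b) := by
    intro b hb
    have hbI : b ∈ Icc 0 t := ⟨hb.1.le, hb.2.le⟩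
    have hs : 0 < ν * (t - b) := mul_pos hν (by linarith [hb.2])
    rw [heatExtension_eq_integral_sub]
    simp only [smul_eq_mul]
    have hGint : Integrable fun c => heatKernel (E := ℝ) (ν * (t - b)) (c₀ - c) :=
      (integrable_heatKernel_holds (E := ℝ) hs).comp_sub_left c₀
    have iB := integrable_heatKernel_sub_mul hs c₀ (continuous_slice_right hcont hbI) (hB b hbI)
    have iT := integrable_heatKernel_sub_mul hs c₀ hφt_cont (hB t htI)
    rw [← integral_sub iB iT]
    have hmvt : ∀ c, |φ b c - φ t c| ≤ B * (t - b) := by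
      intro c
      have h := norm_image_sub_le_of_norm_deriv_right_le_segment (f := fun τ => φ τ c)
        (f' := fun τ => φₜ τ c) (a := b) (b := t) (C := B)
        ((continuousOn_slice_left hcont c).mono (Icc_subset_Icc hb.1.le le_rfl))
        (fun x hx => (hdt x ⟨lt_of_lt_of_le hb.1 hx.1, hx.2⟩ c).hasDerivWithinAt)
        (fun x hx => by rw [Real.norm_eq_abs]; exact hBt x ⟨lt_of_lt_of_le hb.1 hx.1, hx.2⟩ c)
        t ⟨hb.2.le, le_rfl⟩
      rw [Real.norm_eq_abs] at h
      rwa [abs_sub_comm]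
    calc |∫ c, (heatKernel (ν * (t - b)) (c₀ - c) * φ b c - heatKernel (ν * (t - b)) (c₀ - c) * φ t c)|
        ≤ ∫ c, |heatKernel (ν * (t - b)) (c₀ - c) * φ b c -
            heatKernel (ν * (t - b)) (c₀ - c) * φ t c| := abs_integral_le_integral_abs
      _ ≤ ∫ c, heatKernel (ν * (t - b)) (c₀ - c) * (B * (t - b)) := by
          refine integral_mono (iB.sub iT).abs (hGint.mul_const _) fun c => ?_
          dsimp only
          rw [← mul_sub, abs_mul, abs_of_nonneg (heatKernel_real_nonneg hs _)]
          exact mul_le_mul_of_nonneg_left (hmvt c) (heatKernel_real_nonneg hs _)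
      _ = B * (t - b) := by rw [integral_mul_const, integral_heatKernel_sub_eq_one hs, one_mul]
  have hsmall : Tendsto (fun b => (∫ c, heatKernel (ν * (t - b)) (c₀ - c) * φ b c) -
      heatExtension (φ t) (ν * (t - b)) c₀) (𝓝[<] t) (𝓝 0) := by
    refine squeeze_zero_norm' (a := fun b => B * (t - b)) ?_ ?_
    · filter_upwards [Ioo_mem_nhdsLT ht] with b hb
      rw [Real.norm_eq_abs]
      exact hdiff b hb
    · have hc : Continuous fun b : ℝ => B * (t - b) := by fun_prop
      have h3 := hc.tendsto t
      simp only [sub_self, mul_zero] at h3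
      exact h3.mono_left nhdsWithin_le_nhds
  have h := hE.add hsmall
  simp only [add_zero] at h
  refine h.congr' (Eventually.of_forall fun b => ?_)
  dsimp only
  ring

/-! ### The duality bound -/

/-- **Duhamel comparison for bounded classical subsolutions of the heat equation on the line (duality
form).** Let `0 < ν`, `0 < t`, and let `φ : [0,t] × ℝ → ℝ` be jointly continuous and bounded by `B`, with
time derivative `φₜ` on `(0,t)` and space derivatives `φ₁ = ∂_cφ`, `φ₂ = ∂_c²φ` on `(0,t)`, all bounded by
`B`, `φₜ, φ₂` jointly continuous on `(0,t) × ℝ`, satisfying the differential inequality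
`φₜ − ν φ₂ ≤ S` on `(0,t) × ℝ` and `φ(0, ·) ≤ M₀`. Then for every `c₀`,

  `φ(t, c₀) ≤ M₀ + (4π)^{-1/2} ∫_{(0,t)} (ν(t−τ))^{-1/2} (∫ S(τ,c)⁺ dc) dτ`

in `ℝ≥0∞` (the source enters only through `∫⁻ ofReal S`: no measurability, sign or integrability of `S`
is needed; an infinite right-hand side is allowed). Proof: test against the heat kernel,
`I(τ) = ∫ G_{ν(t−τ)}(c₀ − c) φ(τ,c) dc`; differentiating under the integral and integrating by parts twice
(the kernel solves the backward equation in `τ`) gives `I' = ∫ G (φₜ − νφ₂) ≤ ∫ G S ≤ sup G · ∫ S⁺`, and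
`I(0⁺) = I(0) ≤ M₀`, `I(t⁻) = φ(t,c₀)` (approximate identity plus the time-Lipschitz bound `|φₜ| ≤ B`). -/
theorem heat_subsolution_duhamel_bound : ∀ (ν t B M₀ : ℝ), 0 < ν → 0 < t → ∀ (φ φₜ φ₁ φ₂ S : ℝ → ℝ → ℝ), ContinuousOn (Function.uncurry φ) (Set.Icc 0 t ×ˢ Set.univ) → ContinuousOn (Function.uncurry φₜ) (Set.Ioo 0 t ×ˢ Set.univ) → ContinuousOn (Function.uncurry φ₂) (Set.Ioo 0 t ×ˢ Set.univ) → (∀ τ ∈ Set.Ioo 0 t, ∀ c, HasDerivAt (fun σ => φ σ c) (φₜ τ c) τ) → (∀ τ ∈ Set.Ioo 0 t, ∀ c, HasDerivAt (φ τ) (φ₁ τ c) c) → (∀ τ ∈ Set.Ioo 0 t, ∀ c, HasDerivAt (φ₁ τ) (φ₂ τ c) c) → (∀ τ ∈ Set.Icc 0 t, ∀ c, |φ τ c| ≤ B) → (∀ τ ∈ Set.Ioo 0 t, ∀ c, |φₜ τ c| ≤ B) → (∀ τ ∈ Set.Ioo 0 t, ∀ c, |φ₁ τ c| ≤ B) →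 (∀ τ ∈ Set.Ioo 0 t, ∀ c, |φ₂ τ c| ≤ B) → (∀ τ ∈ Set.Ioo 0 t, ∀ c, φₜ τ c - ν * φ₂ τ c ≤ S τ c) → (∀ c, φ 0 c ≤ M₀) → ∀ (c₀ : ℝ), ENNReal.ofReal (φ t c₀) ≤ ENNReal.ofReal M₀ + ENNReal.ofReal (1 / Real.sqrt (4 * Real.pi)) * ∫⁻ τ in Set.Ioo 0 t, ENNReal.ofReal (1 / Real.sqrt (ν * (t - τ))) * ∫⁻ c, ENNReal.ofReal (S τ c) := by
  intro ν t B M₀ hν ht φ φₜ φ₁ φ₂ S hcont hcont_t hcont_2 hdt hd1 hd2 hB hBt hB1 hB2 hsub hinit c₀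
  -- ### notation
  set I : ℝ → ℝ := fun τ => ∫ c, heatKernel (ν * (t - τ)) (c₀ - c) * φ τ c with hI
  set I' : ℝ → ℝ := fun τ => ∫ c, heatKernel (ν * (t - τ)) (c₀ - c) * (φₜ τ c - ν * φ₂ τ c) with hI'
  set X : ℝ≥0∞ := ENNReal.ofReal (1 / Real.sqrt (4 * π)) *
      ∫⁻ τ in Ioo 0 t, ENNReal.ofReal (1 / Real.sqrt (ν * (t - τ))) *
        ∫⁻ c, ENNReal.ofReal (S τ c) with hX
  have hs_pos : ∀ τ, τ < t → 0 < ν * (t - τ) := fun τ hτ => mul_pos hν (by linarith)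
  have hIcc : ∀ τ ∈ Ioo 0 t, τ ∈ Icc 0 t := fun τ hτ => ⟨hτ.1.le, hτ.2.le⟩
  -- ### slice regularity
  have hφc : ∀ τ ∈ Icc 0 t, Continuous (φ τ) := fun τ hτ => continuous_slice_right hcont hτ
  have hφtc : ∀ τ ∈ Ioo 0 t, Continuous (φₜ τ) := fun τ hτ => continuous_slice_right hcont_t hτ
  have hφ2c : ∀ τ ∈ Ioo 0 t, Continuous (φ₂ τ) := fun τ hτ => continuous_slice_right hcont_2 hτ
  have hHcont : ContinuousOn (Function.uncurry fun τ c => φₜ τ c - ν * φ₂ τ c) (Ioo 0 t ×ˢ univ) :=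
    hcont_t.sub (continuousOn_const.mul hcont_2)
  have hH_le : ∀ τ ∈ Ioo 0 t, ∀ c, |φₜ τ c - ν * φ₂ τ c| ≤ (1 + ν) * B := by
    intro τ hτ c
    calc |φₜ τ c - ν * φ₂ τ c| ≤ |φₜ τ c| + |ν * φ₂ τ c| := abs_sub _ _
      _ ≤ B + ν * B := by
          rw [abs_mul, abs_of_pos hν]
          exact add_le_add (hBt τ hτ c) (mul_le_mul_of_nonneg_left (hB2 τ hτ c) hν.le)
      _ = (1 + ν) * B := by ring
  -- ### Step A: `I' = dI/dτ` on `(0,t)` (differentiate under the integral, integrate by parts twice)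
  have hderiv : ∀ τ ∈ Ioo 0 t, HasDerivAt I (I' τ) τ := by
    intro τ hτ
    have hs : 0 < ν * (t - τ) := hs_pos τ hτ.2
    have hraw := hasDerivAt_integral_heatKernel_mul ν t B hν φ φₜ τ hτ
      (fun σ hσ => hφc σ (hIcc σ hσ)) (hφtc τ hτ) hdt (fun σ hσ c => hB σ (hIcc σ hσ) c) hBt c₀
    have hibp := integral_heatKernel_sub_second_deriv_mul hs c₀ (hd1 τ hτ) (hd2 τ hτ) (hφ2c τ hτ)
      (hB τ (hIcc τ hτ)) (hB1 τ hτ) (hB2 τ hτ)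
    -- integrability of the three pieces
    have i1 : Integrable fun c => heatKernel (ν * (t - τ)) (c₀ - c) * φₜ τ c :=
      integrable_heatKernel_sub_mul hs c₀ (hφtc τ hτ) (hBt τ hτ)
    have i3 : Integrable fun c => heatKernel (ν * (t - τ)) (c₀ - c) * φ₂ τ c :=
      integrable_heatKernel_sub_mul hs c₀ (hφ2c τ hτ) (hB2 τ hτ)
    have i2 : Integrable fun c => ((c₀ - c) ^ 2 / (4 * (ν * (t - τ)) ^ 2) - 1 / (2 * (ν * (t - τ)))) *
        heatKernel (ν * (t - τ)) (c₀ - c) * φ τ c := by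
      obtain ⟨C₂, hC₂0, hC₂⟩ := abs_weight_mul_heatKernel_le_gaussian_of_mem_Icc hs
      have hsI : ν * (t - τ) ∈ Icc (ν * (t - τ) / 2) (2 * (ν * (t - τ))) := ⟨by linarith, by linarith⟩
      have hB0 : 0 ≤ B := (abs_nonneg _).trans (hB τ (hIcc τ hτ) 0)
      have hw : Continuous fun c : ℝ =>
          (c₀ - c) ^ 2 / (4 * (ν * (t - τ)) ^ 2) - 1 / (2 * (ν * (t - τ))) := by fun_prop
      have hGc : Continuous fun c => heatKernel (ν * (t - τ)) (c₀ - c) :=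
        (continuous_heatKernel (E := ℝ) _).comp (continuous_const.sub continuous_id)
      refine integrable_of_abs_le_gaussian (b := 1 / (16 * (ν * (t - τ)))) (by positivity) c₀
        (C := C₂ * B) ((hw.mul hGc).mul (hφc τ (hIcc τ hτ))).aestronglyMeasurable fun c => ?_
      rw [abs_mul, abs_mul, abs_of_nonneg (heatKernel_real_nonneg hs _), mul_assoc C₂, mul_comm B,
        ← mul_assoc C₂]
      exact mul_le_mul (hC₂ _ hsI (c₀ - c)) (hB τ (hIcc τ hτ) c) (abs_nonneg _) (by positivity)
    have eL : (∫ c, (heatKernel (ν * (t - τ)) (c₀ - c) * φₜ τ c -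
        ν * (((c₀ - c) ^ 2 / (4 * (ν * (t - τ)) ^ 2) - 1 / (2 * (ν * (t - τ)))) *
          heatKernel (ν * (t - τ)) (c₀ - c)) * φ τ c)) =
        (∫ c, heatKernel (ν * (t - τ)) (c₀ - c) * φₜ τ c) -
          ν * ∫ c, heatKernel (ν * (t - τ)) (c₀ - c) * φ₂ τ c := by
      rw [← hibp, ← integral_const_mul, ← integral_sub i1 (i2.const_mul ν)]
      refine integral_congr_ae (ae_of_all _ fun c => ?_)
      ring
    have eR : I' τ = (∫ c, heatKernel (ν * (t - τ)) (c₀ - c) * φₜ τ c) -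
        ν * ∫ c, heatKernel (ν * (t - τ)) (c₀ - c) * φ₂ τ c := by
      rw [← integral_const_mul, ← integral_sub i1 (i3.const_mul ν)]
      refine integral_congr_ae (ae_of_all _ fun c => ?_)
      ring
    rw [eR, ← eL]
    exact hraw
  -- ### Step B: `I'` is continuous on `(0,t)`
  have hI'cont : ContinuousOn I' (Ioo 0 t) := fun τ hτ =>
    (continuousAt_integral_heatKernel_mul (t := t) hν hτ hHcont hH_le c₀).continuousWithinAt
  -- ### Step C: the pointwise bound `I'(τ) ≤ (4π)^{-1/2} (ν(t−τ))^{-1/2} ∫ S⁺`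
  have hI'_le : ∀ τ ∈ Ioo 0 t, ENNReal.ofReal (I' τ) ≤ ENNReal.ofReal (1 / Real.sqrt (4 * π)) *
      (ENNReal.ofReal (1 / Real.sqrt (ν * (t - τ))) * ∫⁻ c, ENNReal.ofReal (S τ c)) := by
    intro τ hτ
    have hs : 0 < ν * (t - τ) := hs_pos τ hτ.2
    set Gm : ℝ := 1 / Real.sqrt (4 * π) * (1 / Real.sqrt (ν * (t - τ))) with hGm
    have hGm0 : 0 ≤ Gm := by positivity
    calc ENNReal.ofReal (I' τ)
        ≤ ∫⁻ c, ENNReal.ofReal (heatKernel (ν * (t - τ)) (c₀ - c) * (φₜ τ c - ν * φ₂ τ c)) :=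
          Literature.Analysis.FunctionSpaces.ofReal_integral_le_lintegral_ofReal' _
      _ ≤ ∫⁻ c, ENNReal.ofReal Gm * ENNReal.ofReal (S τ c) := by
          refine lintegral_mono fun c => ?_
          have hG0 := heatKernel_real_nonneg hs (c₀ - c)
          have hGH : heatKernel (ν * (t - τ)) (c₀ - c) * (φₜ τ c - ν * φ₂ τ c) ≤ Gm * max (S τ c) 0 :=
            calc heatKernel (ν * (t - τ)) (c₀ - c) * (φₜ τ c - ν * φ₂ τ c)
                ≤ heatKernel (ν * (t - τ)) (c₀ - c) * S τ c := mul_le_mul_of_nonneg_left (hsub τ hτ c) hG0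
              _ ≤ heatKernel (ν * (t - τ)) (c₀ - c) * max (S τ c) 0 :=
                  mul_le_mul_of_nonneg_left (le_max_left _ _) hG0
              _ ≤ Gm * max (S τ c) 0 :=
                  mul_le_mul_of_nonneg_right (heatKernel_real_le hs _) (le_max_right _ _)
          calc ENNReal.ofReal (heatKernel (ν * (t - τ)) (c₀ - c) * (φₜ τ c - ν * φ₂ τ c))
              ≤ ENNReal.ofReal (Gm * max (S τ c) 0) := ENNReal.ofReal_le_ofReal hGH
            _ = ENNReal.ofReal Gm * ENNReal.ofReal (max (S τ c) 0) := ENNReal.ofReal_mul hGm0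
            _ = ENNReal.ofReal Gm * ENNReal.ofReal (S τ c) := by
                congr 1
                rcases le_total (S τ c) 0 with h | h
                · rw [max_eq_right h, ENNReal.ofReal_zero, ENNReal.ofReal_of_nonpos h]
                · rw [max_eq_left h]
      _ = ENNReal.ofReal Gm * ∫⁻ c, ENNReal.ofReal (S τ c) :=
          lintegral_const_mul' _ _ ENNReal.ofReal_ne_top
      _ = _ := by rw [hGm, ENNReal.ofReal_mul (by positivity), mul_assoc]
  -- ### Step D: `I(b) − I(a) ≤ X` for `0 < a ≤ b < t` (fundamental theorem of calculus)
  have hIab : ∀ a b, 0 < a → a ≤ b → b < t → ENNReal.ofReal (I b - I a) ≤ X := by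
    intro a b ha hab hbt
    have hsub' : uIcc a b ⊆ Ioo 0 t := by
      rw [uIcc_of_le hab]
      exact fun τ hτ => ⟨lt_of_lt_of_le ha hτ.1, lt_of_le_of_lt hτ.2 hbt⟩
    have hftc : ∫ τ in a..b, I' τ = I b - I a :=
      intervalIntegral.integral_eq_sub_of_hasDerivAt (fun τ hτ => hderiv τ (hsub' hτ))
        ((hI'cont.mono hsub').intervalIntegrable)
    rw [← hftc, intervalIntegral.integral_of_le hab]
    calc ENNReal.ofReal (∫ τ in Ioc a b, I' τ) ≤ ∫⁻ τ in Ioc a b, ENNReal.ofReal (I' τ) :=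
          Literature.Analysis.FunctionSpaces.ofReal_integral_le_lintegral_ofReal' _
      _ ≤ ∫⁻ τ in Ioc a b, ENNReal.ofReal (1 / Real.sqrt (4 * π)) *
            (ENNReal.ofReal (1 / Real.sqrt (ν * (t - τ))) * ∫⁻ c, ENNReal.ofReal (S τ c)) :=
          setLIntegral_mono' measurableSet_Ioc fun τ hτ =>
            hI'_le τ ⟨ha.trans hτ.1, lt_of_le_of_lt hτ.2 hbt⟩
      _ ≤ ∫⁻ τ in Ioo 0 t, ENNReal.ofReal (1 / Real.sqrt (4 * π)) *
            (ENNReal.ofReal (1 / Real.sqrt (ν * (t - τ))) * ∫⁻ c, ENNReal.ofReal (S τ c)) :=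
          lintegral_mono_set fun τ hτ => ⟨ha.trans hτ.1, lt_of_le_of_lt hτ.2 hbt⟩
      _ = X := by rw [hX, lintegral_const_mul' _ _ ENNReal.ofReal_ne_top]
  -- ### Step E: the endpoint limits and the initial bound
  have hI0eq : I 0 = ∫ c, heatKernel (ν * t) (c₀ - c) * φ 0 c := by simp only [hI, sub_zero]
  have hlim0 : Tendsto I (𝓝[>] 0) (𝓝 (I 0)) := by
    rw [hI0eq]
    exact tendsto_integral_heatKernel_mul_nhdsGT_zero hν ht hcont hB c₀
  have hlimt : Tendsto I (𝓝[<] t) (𝓝 (φ t c₀)) :=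
    tendsto_integral_heatKernel_mul_nhdsLT hν ht hcont hdt hB hBt c₀
  have hI0 : I 0 ≤ M₀ := by
    rw [hI0eq]
    exact integral_heatKernel_sub_mul_le (mul_pos hν ht) c₀ (hφc 0 ⟨le_rfl, ht.le⟩)
      (hB 0 ⟨le_rfl, ht.le⟩) hinit
  -- ### Step F: conclusion
  by_cases hXtop : X = ⊤
  · rw [hXtop, add_top]
    exact le_top
  have hxX : ENNReal.ofReal X.toReal = X := ENNReal.ofReal_toReal hXtop
  have hreal : ∀ a b, 0 < a → a ≤ b → b < t → I b - I a ≤ X.toReal := by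
    intro a b ha hab hbt
    have h := hIab a b ha hab hbt
    rw [← hxX] at h
    exact (ENNReal.ofReal_le_ofReal_iff ENNReal.toReal_nonneg).1 h
  have hb0 : ∀ b ∈ Ioo 0 t, I b - I 0 ≤ X.toReal := by
    intro b hb
    have hl : Tendsto (fun a => I b - I a) (𝓝[>] 0) (𝓝 (I b - I 0)) := tendsto_const_nhds.sub hlim0
    refine le_of_tendsto hl ?_
    filter_upwards [Ioo_mem_nhdsGT hb.1] with a ha
    exact hreal a b ha.1 ha.2.le hb.2
  have hfin : φ t c₀ - I 0 ≤ X.toReal := by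
    have hl : Tendsto (fun b => I b - I 0) (𝓝[<] t) (𝓝 (φ t c₀ - I 0)) := hlimt.sub tendsto_const_nhds
    refine le_of_tendsto hl ?_
    filter_upwards [Ioo_mem_nhdsLT ht] with b hb
    exact hb0 b hb
  have hφle : φ t c₀ ≤ M₀ + X.toReal := by linarith
  calc ENNReal.ofReal (φ t c₀) ≤ ENNReal.ofReal (M₀ + X.toReal) := ENNReal.ofReal_le_ofReal hφle
    _ ≤ ENNReal.ofReal M₀ + ENNReal.ofReal X.toReal := ENNReal.ofReal_add_le
    _ = ENNReal.ofReal M₀ + X := by rw [hxX]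


/-- **The duality bound with the initial supremum.** Same as `heat_subsolution_duhamel_bound`, with
`ofReal M₀` replaced by `⨆_c ofReal (φ(0, c))` (the initial profile is bounded by `B`, so its real supremum
exists and `ofReal` commutes with it): the shape consumed by the `ε → 0⁺` reduction
`planarFlux_le_of_forall_eps` of `SlicedKelvinPlanarFluxAPrioriEpsilonLimit`. -/
theorem heat_subsolution_duhamel_bound_iSup {ν t B : ℝ} (hν : 0 < ν) (ht : 0 < t)
    {φ φₜ φ₁ φ₂ S : ℝ → ℝ → ℝ}
    (hcont : ContinuousOn (Function.uncurry φ) (Icc 0 t ×ˢ univ))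
    (hcont_t : ContinuousOn (Function.uncurry φₜ) (Ioo 0 t ×ˢ univ))
    (hcont_2 : ContinuousOn (Function.uncurry φ₂) (Ioo 0 t ×ˢ univ))
    (hdt : ∀ τ ∈ Ioo 0 t, ∀ c, HasDerivAt (fun σ => φ σ c) (φₜ τ c) τ)
    (hd1 : ∀ τ ∈ Ioo 0 t, ∀ c, HasDerivAt (φ τ) (φ₁ τ c) c)
    (hd2 : ∀ τ ∈ Ioo 0 t, ∀ c, HasDerivAt (φ₁ τ) (φ₂ τ c) c)
    (hB : ∀ τ ∈ Icc 0 t, ∀ c, |φ τ c| ≤ B) (hBt : ∀ τ ∈ Ioo 0 t, ∀ c, |φₜ τ c| ≤ B)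
    (hB1 : ∀ τ ∈ Ioo 0 t, ∀ c, |φ₁ τ c| ≤ B) (hB2 : ∀ τ ∈ Ioo 0 t, ∀ c, |φ₂ τ c| ≤ B)
    (hsub : ∀ τ ∈ Ioo 0 t, ∀ c, φₜ τ c - ν * φ₂ τ c ≤ S τ c) (c₀ : ℝ) :
    ENNReal.ofReal (φ t c₀) ≤ (⨆ c, ENNReal.ofReal (φ 0 c)) + ENNReal.ofReal (1 / Real.sqrt (4 * π)) *
      ∫⁻ τ in Ioo 0 t, ENNReal.ofReal (1 / Real.sqrt (ν * (t - τ))) * ∫⁻ c, ENNReal.ofReal (S τ c) := by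
  have h0 : (0 : ℝ) ∈ Icc 0 t := ⟨le_rfl, ht.le⟩
  have hbdd : BddAbove (Set.range fun c => φ 0 c) := by
    refine ⟨B, ?_⟩
    rintro _ ⟨c, rfl⟩
    exact (le_abs_self _).trans (hB 0 h0 c)
  have h := heat_subsolution_duhamel_bound ν t B (⨆ c, φ 0 c) hν ht φ φₜ φ₁ φ₂ S hcont hcont_t hcont_2
    hdt hd1 hd2 hB hBt hB1 hB2 hsub (fun c => le_ciSup hbdd c) c₀
  have e : ENNReal.ofReal (⨆ c, φ 0 c) = ⨆ c, ENNReal.ofReal (φ 0 c) :=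
    Monotone.map_ciSup_of_continuousAt ENNReal.continuous_ofReal.continuousAt
      (fun _ _ hxy => ENNReal.ofReal_le_ofReal hxy) hbdd
  rwa [e] at h

end Summit.NavierStokesRegularity.NavierStokesRegularity.Theorems.SlicedKelvinPlanarFluxAPriori

end
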